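import Literature.Geometry.Symplectic.PlanarContactBoundary
import Literature.Geometry.Symplectic.SteinMorsePerturbation
import Literature.Geometry.Symplectic.SteinMorseIndex
import Literature.Geometry.Symplectic.SteinDomainComponents
import Literature.Topology.FourManifolds.LickorishWallaceProofs
import Literature.AlgebraicTopology.SingularHomology.SingularChains
import Literature.AlgebraicTopology.SingularHomology.ClopenAdditivity
import Literature.AlgebraicTopology.SingularHomology.RelativeHomology
import HarnessLib

/-!
# Etnyre's planar-filling theorem (Stein case): the two homological clauses, as a named fact

Etnyre, *Planar open book decompositions and contact structures*, IMRN 2004:79, 4255–4267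
(arXiv:math/0404267), Thm. 4.1 (p. 9 of the arXiv version): *"If `X` is a symplectic filling of a
planar contact manifold then `∂X` is connected and `b₂⁺(X) = b₂⁰(X) = 0`"* (`b₂⁰(X)` = the nullity of
the intersection form `q_X`, §1 p. 3).  This file records, as ONE named fact (a `def … : Prop`, to be
discharged by a future Literature proof of Etnyre's theorem — holomorphic-curve filling theory, not in
the tree), the two clauses that route `SmoothPoincare4/ConvexBisection` consumes, stated for compact
Stein domains (`Literature.Geometry.Symplectic.SteinStructure`: a Stein domain is a (strong) symplectic
filling of each component of its contact boundary) whose contact boundary is planar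
(`Literature.Geometry.Symplectic.PlanarContactBoundary`):

* (i) *connected boundary, per component*: `H₀(∂W; ℚ) → H₀(W; ℚ)` is injective (every component of
  `W` has connected boundary — literal "∂W connected" would be false for `B⁴ ⊔ B⁴`; componentwise
  the restricted open book stays planar, binding-free boundary components being excluded by Stokes);
* (ii) *`b₂⁰(W) = 0`, homological avatar*: `H₂(∂W; ℚ) → H₂(W; ℚ)` is the zero map (pair sequence +
  Lefschetz duality + UCT over `ℚ`: `rad q_W = ker(H₂(W) → H₂(W, ∂W)) = im(H₂(∂W) → H₂(W))`).

Deliberately NOT here: the clause `b₂⁺(X) = 0` (needs `b₂⁺` / a relative intersection form for compact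
oriented 4-manifolds with boundary, absent from the tree) and weak fillings.  Consumer:
`Summits/SmoothPoincare4/SmoothPoincare4/Theorems/ConvexBisectionPlanarBisectionRigidityStubEtnyrePlanarAcyclicOfFact.lean`
(planar seam ⇒ ℚ-acyclic halves of a Stein bisection of a homotopy 4-sphere).

## What is proved here

Clause (i) holds — for EVERY compact Stein domain, planar boundary or not — and is proved below
(`SteinStructure.injective_map_boundary_zero`, `EtnyrePlanarFilling.left_holds`), so that the fact
is equivalent to its clause (ii) (`EtnyrePlanarFilling.iff_right`).  The argument is the classical
one for "Stein domains of complex dimension `2` have connected boundary" (Eliashberg 1990, §1;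
Gompf 1998, Thm. 1.3 (a); Milnor 1963, Thms. 3.1–3.2), assembled from the tree: a compact Stein
domain carries a strictly `J`-convex Morse function adapted to `∂W`
(`SteinStructure.exists_isMorseAdapted_levi_pos`, `SteinMorsePerturbation.lean`), its critical
points have index `≤ 2` (`SteinStructure.isHandlebodyOfIndexLE_two_of_isMorseAdapted`,
`SteinMorseIndex.lean`), hence coindex `≥ 2`, the same holds on every connected component
(`isHandlebodyOfIndexLE_opens`, `SteinDomainComponents.lean`), and the top level `∂U = ∂W ∩ U` of
such a function on a compact connected `U` is preconnected and nonempty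
(`IsMorseAdapted.isPreconnected_boundary_and_nonempty`, `LickorishWallaceProofs.lean`);
`H₀` is then read off the clopen partitions of `W` and `∂W` by components (Hatcher 2002,
Props. 2.6–2.7; `ClopenAdditivity.lean`).  Clause (ii) is Etnyre's theorem proper (Eliashberg's
symplectic 2-handles on the binding of a planar open book, the cap `S² × D²`, and McDuff's
classification of symplectic 4-manifolds containing a symplectic sphere of square `0`; Etnyre
2004, §4) and remains a named fact.

## References
* J. B. Etnyre, *Planar open book decompositions and contact structures*, IMRN 2004:79 (arXiv:math/0404267), Thm. 4.1. [Etnyre2004]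
-/

noncomputable section

open scoped Manifold ContDiff Topology ContinuousMap

namespace Literature.Geometry.Symplectic

open Literature.AlgebraicTopology.SingularHomology

/-- **Etnyre 2004, Thm. 4.1 (Stein case; clauses "connected boundary" and `b₂⁰ = 0`).**  For every
compact Stein domain `W` whose contact boundary is planar: (i) the inclusion `∂W ↪ W` is injective on
`H₀(·; ℚ)` (each component of `W` has connected boundary), and (ii) `H₂(∂W; ℚ) → H₂(W; ℚ)` is the zero
map (`b₂⁰(W) = 0`).  Quoted statement: "If `X` is a symplectic filling of a planar contact manifold then
`∂X` is connected and `b₂⁺(X) = b₂⁰(X) = 0`."  Special case in the tree's vocabulary (Stein fillings;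
these two clauses only).  -- TODO(general form): weak symplectic fillings and `b₂⁺(X) = 0`.
[cite: Etnyre2004, Thm. 4.1] -/
def EtnyrePlanarFilling : Prop :=
  (∀ (W : Type) [TopologicalSpace W] [T2Space W] [ChartedSpace (EuclideanHalfSpace 4) W]
      [IsManifold (𝓡∂ 4) ∞ W] [CompactSpace W] (S : SteinStructure W), PlanarContactBoundary S →
      Function.Injective (singularHomology.map ℚ ℚ
        (⟨Subtype.val, continuous_subtype_val⟩ : C(↥((𝓡∂ 4).boundary W), W)) 0)) ∧
  (∀ (W : Type) [TopologicalSpace W] [T2Space W] [ChartedSpace (EuclideanHalfSpace 4) W]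
      [IsManifold (𝓡∂ 4) ∞ W] [CompactSpace W] (S : SteinStructure W), PlanarContactBoundary S →
      singularHomology.map ℚ ℚ
        (⟨Subtype.val, continuous_subtype_val⟩ : C(↥((𝓡∂ 4).boundary W), W)) 2 = 0)

/-- Clause (i) of `EtnyrePlanarFilling`, projected. [cite: Etnyre2004, Thm. 4.1] -/
theorem EtnyrePlanarFilling.injective_map_boundary_zero (h : EtnyrePlanarFilling)
    (W : Type) [TopologicalSpace W] [T2Space W] [ChartedSpace (EuclideanHalfSpace 4) W]
    [IsManifold (𝓡∂ 4) ∞ W] [CompactSpace W] (S : SteinStructure W) (hS : PlanarContactBoundary S) :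
    Function.Injective (singularHomology.map ℚ ℚ
      (⟨Subtype.val, continuous_subtype_val⟩ : C(↥((𝓡∂ 4).boundary W), W)) 0) :=
  h.1 W S hS

/-- Clause (ii) of `EtnyrePlanarFilling`, projected. [cite: Etnyre2004, Thm. 4.1] -/
theorem EtnyrePlanarFilling.map_boundary_two_eq_zero (h : EtnyrePlanarFilling)
    (W : Type) [TopologicalSpace W] [T2Space W] [ChartedSpace (EuclideanHalfSpace 4) W]
    [IsManifold (𝓡∂ 4) ∞ W] [CompactSpace W] (S : SteinStructure W) (hS : PlanarContactBoundary S) :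
    singularHomology.map ℚ ℚ
      (⟨Subtype.val, continuous_subtype_val⟩ : C(↥((𝓡∂ 4).boundary W), W)) 2 = 0 :=
  h.2 W S hS

/-! ### Clause (i): every component of a compact Stein domain has connected boundary -/

section ClauseOne

open Set Function CategoryTheory
open Literature.Topology.FourManifolds Literature.Geometry.Kaehler

universe u

section HZero

variable {A B : Type u} [TopologicalSpace A] [TopologicalSpace B]

/-- If `f : A → B` with `A` and `B` path connected, then `f_* : H₀(A; ℚ) → H₀(B; ℚ)` is
one-to-one (`ε_B ∘ f_* = ε_A`, both augmentations bijective; Hatcher 2002, Prop. 2.7).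
[cite: Hatcher2002, Prop. 2.7] -/
private theorem injective_map_zero_of_pathConnectedSpace' [PathConnectedSpace A]
    [PathConnectedSpace B] (f : C(A, B)) :
    Injective (singularHomology.map ℚ ℚ f 0) := by
  haveI := singularHomology.isIso_ε_of_pathConnectedSpace ℚ ℚ (X := A)
  have ha : Bijective (singularHomology.ε ℚ ℚ A) :=
    ConcreteCategory.bijective_of_isIso (singularHomology.ε ℚ ℚ A)
  have h : (singularHomology.ε ℚ ℚ B) ∘ (singularHomology.map ℚ ℚ f 0) =
      singularHomology.ε ℚ ℚ A := by
    ext x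
    rw [Function.comp_apply, ← ModuleCat.comp_apply, singularHomology.map_ε]
  exact Injective.of_comp (h ▸ ha.1)

end HZero

variable {W : Type u} [TopologicalSpace W] [T2Space W] [ChartedSpace (EuclideanHalfSpace 4) W]
  [IsManifold (𝓡∂ 4) ∞ W] [CompactSpace W]

/-- **Each connected component of a compact Stein domain has connected, nonempty boundary.**
For `S : SteinStructure W` and a connected component `U` of `W` (an open submanifold,
`compOpens W i`), `∂W ∩ U = ∂U` is preconnected and nonempty: `W` carries a Morse function
adapted to `∂W` that is strictly `J`-convex (`SteinStructure.exists_isMorseAdapted_levi_pos`),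
whose critical points have index `≤ 2` (the Levi form is positive on complex lines,
`SteinStructure.isHandlebodyOfIndexLE_two_of_isMorseAdapted`; Gompf 1998, Thm. 1.3 (a)), hence
coindex `≥ 2`; its restriction presents `U` the same way (`isHandlebodyOfIndexLE_opens`), and the
top level of such a function on a compact connected manifold is preconnected and nonempty
(`IsMorseAdapted.isPreconnected_boundary_and_nonempty`; dually, `U` is `∂U × [0, 1]` with handles
of index `≥ 2` attached, Milnor 1963, Thms. 3.1–3.2).  This is the Stein case of the clause
"the boundary of `X` is connected" of Etnyre 2004, Thm. 4.1, valid for every Stein domain.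
[cite: Etnyre2004, Thm. 4.1] [cite: Gompf1998, Thm. 1.3 (a)] -/
theorem SteinStructure.isPreconnected_boundary_inter_compOpens (S : SteinStructure W)
    (i : ConnectedComponents W) :
    IsPreconnected ((𝓡∂ 4).boundary W ∩ (compOpens W i : Set W)) ∧
      ((𝓡∂ 4).boundary W ∩ (compOpens W i : Set W)).Nonempty := by
  obtain ⟨g, hg, hconv⟩ := S.exists_isMorseAdapted_levi_pos
  have hW : IsHandlebodyOfIndexLE 3 2 W := S.isHandlebodyOfIndexLE_two_of_isMorseAdapted hg hconv
  set U : TopologicalSpace.Opens W := compOpens W i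
  obtain ⟨f, hf, hidx⟩ := isHandlebodyOfIndexLE_opens U hW
  haveI : LocallyPathConnectedSpace U :=
    ChartedSpace.locallyPathConnectedSpace (EuclideanHalfSpace 4) U
  have key := hf.isPreconnected_boundary_and_nonempty (n := 3) fun y _ hy => by
    have := hidx y hy
    omega
  rw [ModelWithCorners.boundary_open] at key
  have hr : range (Subtype.val : U → W) = (U : Set W) := Subtype.range_coe (s := (U : Set W))
  constructor
  · have h := key.1.image (Subtype.val : U → W) continuous_subtype_val.continuousOn
    rwa [image_preimage_eq_inter_range, hr] at h
  · obtain ⟨y, hy⟩ := key.2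
    exact ⟨y.1, hy, y.2⟩

/-- **The inclusion `∂W ↪ W` of a compact Stein domain is injective on `H₀(·; ℚ)`** — every
connected component of `W` has connected boundary
(`SteinStructure.isPreconnected_boundary_inter_compOpens`).  Homological form: decompose
`H₀(∂W)` and `H₀(W)` over the clopen partitions by the components `U` of `W` and their traces
`∂W ∩ U` (Hatcher 2002, Prop. 2.6, `ClopenAdditivity.lean`); on each piece
`H₀(∂W ∩ U) → H₀(U)` is injective, both spaces being path connected (Prop. 2.7).  Clause (i) of
`EtnyrePlanarFilling` (Etnyre 2004, Thm. 4.1: "the boundary of `X` is connected"), which thus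
holds for every compact Stein domain, planar boundary or not.
[cite: Etnyre2004, Thm. 4.1] [cite: Hatcher2002, Prop. 2.6–2.7] -/
theorem SteinStructure.injective_map_boundary_zero (S : SteinStructure W) :
    Injective (singularHomology.map ℚ ℚ
      (⟨Subtype.val, continuous_subtype_val⟩ : C(↥((𝓡∂ 4).boundary W), W)) 0) := by
  set ι : C(↥((𝓡∂ 4).boundary W), W) := ⟨Subtype.val, continuous_subtype_val⟩
  haveI : LocallyConnectedSpace W := locallyConnectedSpace_of_chartedSpace W
  haveI : LocallyPathConnectedSpace W :=
    ChartedSpace.locallyPathConnectedSpace (EuclideanHalfSpace 4) W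
  haveI : LocallyPathConnectedSpace ↥((𝓡∂ 4).boundary W) :=
    ChartedSpace.locallyPathConnectedSpace (EuclideanSpace ℝ (Fin 3)) _
  haveI : DiscreteTopology (ConnectedComponents W) :=
    ConnectedComponents.discreteTopology_iff.mpr fun _ => isOpen_connectedComponent
  -- the two clopen partitions: components of `W`, and their traces on `∂W`
  let c : C(W, ConnectedComponents W) :=
    ⟨ConnectedComponents.mk, ConnectedComponents.continuous_coe⟩
  let Bp : ConnectedComponents W → Set W := fun k => c ⁻¹' {k}
  let Ap : ConnectedComponents W → Set ↥((𝓡∂ 4).boundary W) := fun k => (c.comp ι) ⁻¹' {k}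
  have hB : IsClopenPartition Bp := IsClopenPartition.ofContinuous c
  have hA : IsClopenPartition Ap := IsClopenPartition.ofContinuous (c.comp ι)
  have hBp : ∀ k, Bp k = (compOpens W k : Set W) := fun k => rfl
  -- the restricted inclusions `∂W ∩ U ↪ U`
  have hmaps : ∀ k, MapsTo ι (Ap k) (Bp k) := fun k z hz => hz
  let r : ∀ k, C(↥(Ap k), ↥(Bp k)) := fun k => subsetRestrict ι (hmaps k)
  have hfactor : ∀ k, ι.comp (subsetIncl (Ap k)) = (subsetIncl (Bp k)).comp (r k) := fun k => rfl
  -- the pieces are path connected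
  have hBpc : ∀ k, PathConnectedSpace ↥(Bp k) := fun k => by
    obtain ⟨x, rfl⟩ := ConnectedComponents.surjective_coe k
    refine isPathConnected_iff_pathConnectedSpace.mp ?_
    change IsPathConnected (ConnectedComponents.mk ⁻¹' {ConnectedComponents.mk x})
    rw [connectedComponents_preimage_singleton, ← pathComponent_eq_connectedComponent]
    exact isPathConnected_pathComponent
  have hApc : ∀ k, PathConnectedSpace ↥(Ap k) := fun k => by
    refine isPathConnected_iff_pathConnectedSpace.mp ?_
    obtain ⟨hpre, hne⟩ := S.isPreconnected_boundary_inter_compOpens k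
    have himage : Subtype.val '' (Ap k) = (𝓡∂ 4).boundary W ∩ (compOpens W k : Set W) := by
      ext x
      constructor
      · rintro ⟨z, hz, rfl⟩
        exact ⟨z.2, hz⟩
      · rintro ⟨hx, hxU⟩
        exact ⟨⟨x, hx⟩, hxU, rfl⟩
    rw [← himage, Topology.IsInducing.subtypeVal.isPreconnected_image] at hpre
    have hne' : (Ap k).Nonempty := by
      obtain ⟨x, hx⟩ := hne
      rw [← himage] at hx
      obtain ⟨z, hz, -⟩ := hx
      exact ⟨z, hz⟩
    exact ((hA.isOpen k).isConnected_iff_isPathConnected).mp ⟨hne', hpre⟩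
  -- the algebra
  have hcomp : ∀ k, singularHomology.map ℚ ℚ (subsetIncl (Ap k)) 0 ≫ singularHomology.map ℚ ℚ ι 0 =
      singularHomology.map ℚ ℚ (r k) 0 ≫ singularHomology.map ℚ ℚ (subsetIncl (Bp k)) 0 :=
    fun k => by rw [← singularHomology.map_comp, ← singularHomology.map_comp, hfactor]
  rw [injective_iff_map_eq_zero]
  intro y hy
  obtain ⟨T, x, rfl⟩ := singularHomology.exists_eq_sum_map_subsetIncl hA 0 y
  have hsum : ∑ k ∈ T, singularHomology.map ℚ ℚ (subsetIncl (Bp k)) 0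
      (singularHomology.map ℚ ℚ (r k) 0 (x k)) = 0 := by
    rw [map_sum] at hy
    refine (Finset.sum_congr rfl fun k _ => ?_).trans hy
    have h := congrArg (fun φ => φ (x k)) (hcomp k)
    simp only [ModuleCat.comp_apply] at h
    exact h.symm
  refine Finset.sum_eq_zero fun k hk => ?_
  have hk0 : singularHomology.map ℚ ℚ (r k) 0 (x k) = 0 :=
    singularHomology.eq_zero_of_sum_map_subsetIncl_eq_zero hB 0 T _ hsum k hk
  haveI := hApc k
  haveI := hBpc k
  have hx0 : x k = 0 :=
    injective_map_zero_of_pathConnectedSpace' (r k) (hk0.trans (map_zero _).symm)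
  rw [hx0, map_zero]

/-- **Clause (i) of `EtnyrePlanarFilling` holds** (for every compact Stein domain, by
`SteinStructure.injective_map_boundary_zero`; the planarity hypothesis is not used).
[cite: Etnyre2004, Thm. 4.1] -/
theorem EtnyrePlanarFilling.left_holds :
    ∀ (W : Type) [TopologicalSpace W] [T2Space W] [ChartedSpace (EuclideanHalfSpace 4) W]
      [IsManifold (𝓡∂ 4) ∞ W] [CompactSpace W] (S : SteinStructure W), PlanarContactBoundary S →
      Function.Injective (singularHomology.map ℚ ℚ
        (⟨Subtype.val, continuous_subtype_val⟩ : C(↥((𝓡∂ 4).boundary W), W)) 0) :=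
  fun _ _ _ _ _ _ S _ => S.injective_map_boundary_zero

/-- **`EtnyrePlanarFilling` is equivalent to its clause (ii)** (`b₂⁰ = 0`:
`H₂(∂W; ℚ) → H₂(W; ℚ)` vanishes for compact Stein domains with planar contact boundary), clause
(i) being proved (`EtnyrePlanarFilling.left_holds`).  What remains is Etnyre's theorem proper
(symplectic cap of a planar open book and McDuff's classification of ruled symplectic
4-manifolds). [cite: Etnyre2004, Thm. 4.1] -/
theorem EtnyrePlanarFilling.iff_right :
    EtnyrePlanarFilling ↔
      ∀ (W : Type) [TopologicalSpace W] [T2Space W] [ChartedSpace (EuclideanHalfSpace 4) W]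
        [IsManifold (𝓡∂ 4) ∞ W] [CompactSpace W] (S : SteinStructure W),
        PlanarContactBoundary S →
        singularHomology.map ℚ ℚ
          (⟨Subtype.val, continuous_subtype_val⟩ : C(↥((𝓡∂ 4).boundary W), W)) 2 = 0 :=
  ⟨fun h => h.2, fun h => ⟨EtnyrePlanarFilling.left_holds, h⟩⟩

end ClauseOne

end Literature.Geometry.Symplectic

end
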